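import Mathlib
import HarnessLib
import Summits.HubbardSuperconductivity.HubbardSuperconductivity.Theorems.KLProgrammeKLRegimeTwoVolumeTowerBaseTransferW
import Summits.HubbardSuperconductivity.HubbardSuperconductivity.Theorems.KLProgrammeKLRegimeTwoVolumeTowerBaseTransferBlockCov
import Summits.HubbardSuperconductivity.HubbardSuperconductivity.Theorems.KLProgrammeKLRegimeTwoVolumeTowerBaseTransferFrameDiff

/-!
# Route `KLProgramme` — crux K3, VL child (stmt-HubbardSuperconductivity-20440), window key «(VL)-SRC-WINDOW» (pen (R235)), atom HB1W (transfer half):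
# THE WINDOWED BASE-TRANSFER BUNDLE AT ONE INSTANCE FROM ITS ANALYTIC ATOMS
# (seat hubbard-kl-k3c4-p1 g17; the W-twins of g14's `…TowerBaseTransferFrameDiff` / `…TowerBaseTransferRows` / `…TowerBaseTransferBlockCov` §3 /
# `…TowerBaseTransferData` with `klBaseTransfer ↦ klBaseTransferW`, `klSrcWindowBlock ↦ klSrcWindowBlock`)

The windowed base-transfer bundle `hdataT` of `…TowerBaseW.tower_baseW_keyedDefectTSW_eventually_le` / `…TowerBaseGridLimitMomW.towerData_h0W_of_baseDataM` is, at one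
instance `(L, b, M)` and frames `(Kc, Kf)`, a 7-tuple about `klBaseTransferW (bL) M β μ Kc`, its frame difference against `Kf`, and the two grid actions.  This
file assembles it from the ANALYTIC ATOMS: the `(1 + Λ_T·tnorm)`-weighted rows/columns of the alive block `ε • E(F_0[Kc])·S_N` (p3 g18's
`…TowerBaseAliveBlockRows`, p641129) and of the WINDOWED source block `klSrcWindowBlock·S_N = ε·E(F_χ)·S_N` (p3 g18's `…TowerBaseSrcWindowRows.windowBlock_wtRows_le`,
p647382 — `M`-uniform, unlike the plain block), the rows/columns of the frame difference `ε • (E(F_0[Kf]) − E(F_0[Kc]))·S_N` (the window block is frame-free, so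
it cancels: `klBaseTransferW_sub_apply`), the two grid actions' weighted profiles (passed through), the block covariance being a theorem
(`klBaseTransferW_blockCovariant`: both blocks are cross-grid overlap kernels `E(F)·S_N`, translation invariant in space by `gridOverlap_translate`).
* §1 `klBaseTransferW_apply_zero_zero/_one_one/_zero_one/_one_zero`, `klBaseTransferW_sub_apply`, `sum_norm_klBaseTransferW_sub_row_le/_col_le`;
* §2 `sum_norm_klBaseTransferW_mul_wt_row_le/_col_le`;
* §3 `klBaseTransferW_translate`, `klBaseTransferW_blockCovariant`;
* §4 **`towerBase_transferDataW_of_atoms`**.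

Proofs only; no definition; nothing asserts HB1W, any stub, K3, VL or superconductivity. [cite: BenfattoGiulianiMastropietro2006, §2.7 (2.70)–(2.71a), §2.9 (4.6)-(4.8), §3 (3.3)]
-/

noncomputable section

namespace Summit.HubbardSuperconductivity.HubbardSuperconductivity.Theorems.TwoVolumeSource

set_option linter.dupNamespace false -- summit = problem name (single-conjunct summit), D-0017

open Finset Filter Topology Literature.MathematicalPhysics.QuantumLattice GrassmannAlgebra Literature.Probability.LatticeModels
  Literature.Probability.LatticeModels.BattleFederbush
open Summit.HubbardSuperconductivity.HubbardSuperconductivity.Theorems.TwoPointAssembly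
open Summit.HubbardSuperconductivity.HubbardSuperconductivity.Theorems.KLRegimeSplit
open Summit.HubbardSuperconductivity.HubbardSuperconductivity.Theorems.KLProgrammeLegKernels
open Summit.HubbardSuperconductivity.HubbardSuperconductivity.Theorems.EngineV8
open Summit.HubbardSuperconductivity.HubbardSuperconductivity.Theorems.TwoVolumeDefect

/-! ## §1 Entries and the frame difference -/

section Entries

variable {V M : ℕ} [NeZero V]

/-- Entries of the base transfer between the alive copies `0`: the scaled overlap `ε • E(F_0[K])·S_N`. [folklore] -/
theorem klBaseTransferW_apply_zero_zero (β μ : ℝ) (K : TrigPolyC4v) (Y : SpaceTimeIdx V M × SectorLeg (sectorCount 0))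
    (y : GridLeg (GridPoint V (klGridN M))) :
    klBaseTransferW V M β μ K (Y, 0) (y, 0) =
      ((((imagTimeWeight β M : ℝ) : ℂ) • sectorAnalysisMatrix V M β (klAnisoFamily V M β μ K klE0 0)) * hubbardGridSub V M β (klGridN M)) Y y := by
  rw [klBaseTransferW_apply, if_pos ⟨rfl, rfl⟩]

/-- Entries between the source copies `1`: the windowed source block (frame-free). [folklore] -/
theorem klBaseTransferW_apply_one_one (β μ : ℝ) (K : TrigPolyC4v) (Y : SpaceTimeIdx V M × SectorLeg (sectorCount 0))
    (y : GridLeg (GridPoint V (klGridN M))) :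
    klBaseTransferW V M β μ K (Y, 1) (y, 1) = (klSrcWindowBlock V M β * hubbardGridSub V M β (klGridN M)) Y y := by
  rw [klBaseTransferW_apply]; dsimp only; rw [if_neg (by decide), if_pos ⟨rfl, rfl⟩]

/-- Entries from copy `0` to copy `1` vanish. [folklore] -/
theorem klBaseTransferW_apply_zero_one (β μ : ℝ) (K : TrigPolyC4v) (Y : SpaceTimeIdx V M × SectorLeg (sectorCount 0))
    (y : GridLeg (GridPoint V (klGridN M))) : klBaseTransferW V M β μ K (Y, 0) (y, 1) = 0 := by
  rw [klBaseTransferW_apply]; dsimp only; rw [if_neg (by decide), if_neg (by decide)]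

/-- Entries from copy `1` to copy `0` vanish. [folklore] -/
theorem klBaseTransferW_apply_one_zero (β μ : ℝ) (K : TrigPolyC4v) (Y : SpaceTimeIdx V M × SectorLeg (sectorCount 0))
    (y : GridLeg (GridPoint V (klGridN M))) : klBaseTransferW V M β μ K (Y, 1) (y, 0) = 0 := by
  rw [klBaseTransferW_apply]; dsimp only; rw [if_neg (by decide), if_neg (by decide)]

/-- **The frame difference of the base transfer, entrywise**: on the alive copies it is the frame difference of the scaled cross-grid overlap, elsewhere `0`.
[cite: BenfattoGiulianiMastropietro2006, §2.7 (2.71)] -/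
theorem klBaseTransferW_sub_apply (β μ : ℝ) (K' K : TrigPolyC4v) (p' : SrcLabel V M 0) (p : GridLeg (GridPoint V (klGridN M)) × Fin 2) :
    klBaseTransferW V M β μ K' p' p - klBaseTransferW V M β μ K p' p =
      if p'.2 = 0 ∧ p.2 = 0 then
        ((((imagTimeWeight β M : ℝ) : ℂ) • (sectorAnalysisMatrix V M β (klAnisoFamily V M β μ K' klE0 0) -
            sectorAnalysisMatrix V M β (klAnisoFamily V M β μ K klE0 0))) * hubbardGridSub V M β (klGridN M)) p'.1 p.1
      else 0 := by
  rw [klBaseTransferW_apply, klBaseTransferW_apply]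
  split_ifs with h00 h11
  · rw [smul_sub, Matrix.sub_mul, Matrix.sub_apply]
  · exact sub_self _
  · exact sub_self _

/-- **Rows of the two-volume difference of the base transfer from rows of the overlap's frame difference.** [cite: BenfattoGiulianiMastropietro2006, §2.7 (2.71), §3 (3.3)] -/
theorem sum_norm_klBaseTransferW_sub_row_le (β μ : ℝ) (K' K : TrigPolyC4v) {δ : ℝ} (hδ : 0 ≤ δ)
    (hrow : ∀ Y : SpaceTimeIdx V M × SectorLeg (sectorCount 0), ∑ y : GridLeg (GridPoint V (klGridN M)),
      ‖((((imagTimeWeight β M : ℝ) : ℂ) • (sectorAnalysisMatrix V M β (klAnisoFamily V M β μ K' klE0 0) -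
          sectorAnalysisMatrix V M β (klAnisoFamily V M β μ K klE0 0))) * hubbardGridSub V M β (klGridN M)) Y y‖ ≤ δ)
    (x : SrcLabel V M 0) :
    ∑ y : GridLeg (GridPoint V (klGridN M)) × Fin 2, ‖klBaseTransferW V M β μ K' x y - klBaseTransferW V M β μ K x y‖ ≤ δ := by
  obtain ⟨Y, c⟩ := x
  simp_rw [klBaseTransferW_sub_apply]
  revert c
  rw [Fin.forall_fin_two]
  refine ⟨?_, ?_⟩
  · rw [Fintype.sum_prod_type]
    simp_rw [Fin.sum_univ_two]
    simp only [true_and, if_true, Fin.one_eq_zero_iff, OfNat.ofNat_ne_one, if_false, norm_zero, add_zero]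
    exact hrow Y
  · rw [Fintype.sum_prod_type]
    simp only [Fin.one_eq_zero_iff, OfNat.ofNat_ne_one, false_and, if_false, norm_zero, Finset.sum_const_zero]
    exact hδ

/-- **Columns of the two-volume difference of the base transfer from columns of the overlap's frame difference.** [cite: BenfattoGiulianiMastropietro2006, §2.7 (2.71), §3 (3.3)] -/
theorem sum_norm_klBaseTransferW_sub_col_le (β μ : ℝ) (K' K : TrigPolyC4v) {δ : ℝ} (hδ : 0 ≤ δ)
    (hcol : ∀ y : GridLeg (GridPoint V (klGridN M)), ∑ Y : SpaceTimeIdx V M × SectorLeg (sectorCount 0),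
      ‖((((imagTimeWeight β M : ℝ) : ℂ) • (sectorAnalysisMatrix V M β (klAnisoFamily V M β μ K' klE0 0) -
          sectorAnalysisMatrix V M β (klAnisoFamily V M β μ K klE0 0))) * hubbardGridSub V M β (klGridN M)) Y y‖ ≤ δ)
    (y : GridLeg (GridPoint V (klGridN M)) × Fin 2) :
    ∑ x : SrcLabel V M 0, ‖klBaseTransferW V M β μ K' x y - klBaseTransferW V M β μ K x y‖ ≤ δ := by
  obtain ⟨yg, c⟩ := y
  simp_rw [klBaseTransferW_sub_apply]
  revert c
  rw [Fin.forall_fin_two]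
  refine ⟨?_, ?_⟩
  · rw [Fintype.sum_prod_type]
    simp_rw [Fin.sum_univ_two]
    simp only [and_true, if_true, Fin.one_eq_zero_iff, OfNat.ofNat_ne_one, if_false, norm_zero, add_zero]
    exact hcol yg
  · rw [Fintype.sum_prod_type]
    simp only [Fin.one_eq_zero_iff, OfNat.ofNat_ne_one, and_false, if_false, norm_zero, Finset.sum_const_zero]
    exact hδ

end Entries

/-! ## §2 Weighted rows and columns from the two blocks -/

section Rows

variable {V M : ℕ} [NeZero V]

/-- **Weighted rows of the base transfer from the weighted rows of its two blocks.** [cite: BenfattoGiulianiMastropietro2006, §2.7 (2.71)] -/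
theorem sum_norm_klBaseTransferW_mul_wt_row_le (β μ : ℝ) (K : TrigPolyC4v) (ΛT cgW : ℝ)
    (hA : ∀ Y : SpaceTimeIdx V M × SectorLeg (sectorCount 0), ∑ y : GridLeg (GridPoint V (klGridN M)),
      ‖((((imagTimeWeight β M : ℝ) : ℂ) • sectorAnalysisMatrix V M β (klAnisoFamily V M β μ K klE0 0)) * hubbardGridSub V M β (klGridN M)) Y y‖ *
        (1 + ΛT * (Torus.tnorm (Y.1.2 - y.1.1.2) : ℝ)) ≤ cgW)
    (hB : ∀ Y : SpaceTimeIdx V M × SectorLeg (sectorCount 0), ∑ y : GridLeg (GridPoint V (klGridN M)),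
      ‖(klSrcWindowBlock V M β * hubbardGridSub V M β (klGridN M)) Y y‖ * (1 + ΛT * (Torus.tnorm (Y.1.2 - y.1.1.2) : ℝ)) ≤ cgW)
    (x : SrcLabel V M 0) :
    ∑ y : GridLeg (GridPoint V (klGridN M)) × Fin 2, ‖klBaseTransferW V M β μ K x y‖ * (1 + ΛT * (Torus.tnorm (x.1.1.2 - y.1.1.1.2) : ℝ)) ≤ cgW := by
  obtain ⟨Y, c⟩ := x
  revert c
  rw [Fin.forall_fin_two]
  refine ⟨?_, ?_⟩
  · rw [Fintype.sum_prod_type]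
    simp_rw [Fin.sum_univ_two, klBaseTransferW_apply_zero_zero, klBaseTransferW_apply_zero_one, norm_zero, zero_mul, add_zero]
    exact hA Y
  · rw [Fintype.sum_prod_type]
    simp_rw [Fin.sum_univ_two, klBaseTransferW_apply_one_zero, klBaseTransferW_apply_one_one, norm_zero, zero_mul, zero_add]
    exact hB Y

/-- **Weighted columns of the base transfer from the weighted columns of its two blocks.** [cite: BenfattoGiulianiMastropietro2006, §2.7 (2.71)] -/
theorem sum_norm_klBaseTransferW_mul_wt_col_le (β μ : ℝ) (K : TrigPolyC4v) (ΛT cgW : ℝ)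
    (hA : ∀ y : GridLeg (GridPoint V (klGridN M)), ∑ Y : SpaceTimeIdx V M × SectorLeg (sectorCount 0),
      ‖((((imagTimeWeight β M : ℝ) : ℂ) • sectorAnalysisMatrix V M β (klAnisoFamily V M β μ K klE0 0)) * hubbardGridSub V M β (klGridN M)) Y y‖ *
        (1 + ΛT * (Torus.tnorm (Y.1.2 - y.1.1.2) : ℝ)) ≤ cgW)
    (hB : ∀ y : GridLeg (GridPoint V (klGridN M)), ∑ Y : SpaceTimeIdx V M × SectorLeg (sectorCount 0),
      ‖(klSrcWindowBlock V M β * hubbardGridSub V M β (klGridN M)) Y y‖ * (1 + ΛT * (Torus.tnorm (Y.1.2 - y.1.1.2) : ℝ)) ≤ cgW)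
    (y : GridLeg (GridPoint V (klGridN M)) × Fin 2) :
    ∑ x : SrcLabel V M 0, ‖klBaseTransferW V M β μ K x y‖ * (1 + ΛT * (Torus.tnorm (x.1.1.2 - y.1.1.1.2) : ℝ)) ≤ cgW := by
  obtain ⟨yg, c⟩ := y
  revert c
  rw [Fin.forall_fin_two]
  refine ⟨?_, ?_⟩
  · rw [Fintype.sum_prod_type]
    simp_rw [Fin.sum_univ_two, klBaseTransferW_apply_zero_zero, klBaseTransferW_apply_one_zero, norm_zero, zero_mul, add_zero]
    exact hA yg
  · rw [Fintype.sum_prod_type]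
    simp_rw [Fin.sum_univ_two, klBaseTransferW_apply_zero_one, klBaseTransferW_apply_one_one, norm_zero, zero_mul, zero_add]
    exact hB yg

end Rows

/-! ## §3 Translation invariance and block covariance -/

section Translate

variable {V M : ℕ} [NeZero V] [NeZero M]

/-- **The windowed base transfer is translation invariant in space** (both blocks are cross-grid overlap kernels). [cite: BenfattoGiulianiMastropietro2006, §2.7 (2.71)] -/
theorem klBaseTransferW_translate {β : ℝ} (hβ : β ≠ 0) (μ : ℝ) (K : TrigPolyC4v) (y₀ : ImagTimeIdx M) (y q z : TorusSite 2 V)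
    (ℓ' : SectorLeg (sectorCount 0)) (s' : Fin 2) (t : Fin (klGridN M)) (σ c s : Fin 2) :
    klBaseTransferW V M β μ K (((y₀, y + z), ℓ'), s') (((((t, q + z), σ), c)), s) = klBaseTransferW V M β μ K (((y₀, y), ℓ'), s') (((((t, q), σ), c)), s) := by
  rw [klBaseTransferW_apply, klBaseTransferW_apply]
  dsimp only
  split_ifs with h00 h11
  · -- the alive block `ε • E(F_0[K]) · S_N`
    rw [Matrix.smul_mul, Matrix.smul_apply, Matrix.smul_apply, gridOverlap_translate hβ]
  · -- the windowed source block
    rw [klSrcWindowBlock_mul_apply, klSrcWindowBlock_mul_apply]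
    dsimp only
    split_ifs with h0
    · rw [gridOverlap_translate hβ]
    · rfl
  · rfl

end Translate

/-- **THE WINDOWED BASE TRANSFER IS BLOCK COVARIANT** (third conjunct of the base-transfer bundle of `…TowerBase` / `towerDataT_of_partsD`): for every frame `K`,
`β ≠ 0`, every `L, b, M`. [cite: BenfattoGiulianiMastropietro2006, §2.7 (2.70)–(2.71a)] -/
theorem klBaseTransferW_blockCovariant {L b M : ℕ} [NeZero L] [NeZero (b * L)] [NeZero M] {β : ℝ} (hβ : β ≠ 0) (μ : ℝ) (K : TrigPolyC4v)
    (δ' β' β₁ : Fin 2 → Fin b) (xbar : SrcLabel L M 0) (y : GridLeg (GridPoint L (klGridN M)) × Fin 2) :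
    ‖klBaseTransferW (b * L) M β μ K ((klBlockEquivD L b M 0).symm (β' + δ', xbar)) ((klGridBlockEquivD L b M).symm (β₁ + δ', y))‖ =
      ‖klBaseTransferW (b * L) M β μ K ((klBlockEquivD L b M 0).symm (β', xbar)) ((klGridBlockEquivD L b M).symm (β₁, y))‖ := by
  obtain ⟨xb, s'⟩ := xbar
  obtain ⟨yg, s⟩ := y
  rw [klBlockEquivD_symm_apply, klBlockEquivD_symm_apply, klGridBlockEquivD_symm_apply, klGridBlockEquivD_symm_apply,
    sectorBlock_symm_add_eq (rfl : b * L = b * L) (klBlockEquiv L b M (sectorCount 0)) (klBlockEquiv_val L b M _) (klBlockEquiv_snd L b M _) β' δ' xb,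
    gridBlock_symm_add_eq (rfl : b * L = b * L) (klGridBlockEquiv L b M) (klGridBlockEquiv_val L b M) (klGridBlockEquiv_snd L b M) β₁ δ' yg]
  set X := (klBlockEquiv L b M (sectorCount 0)).symm (β', xb) with hX
  set Y := (klGridBlockEquiv L b M).symm (β₁, yg) with hY
  obtain ⟨⟨y₀, ys⟩, ℓ'⟩ := X
  obtain ⟨⟨⟨t, q⟩, σ⟩, c⟩ := Y
  dsimp only
  rw [klBaseTransferW_translate hβ]

/-! ## §4 The bundle -/

/-- **THE WINDOWED BASE-TRANSFER BUNDLE AT ONE INSTANCE FROM ITS ANALYTIC ATOMS** (see the module docstring). [cite: BenfattoGiulianiMastropietro2006, §2.7 (2.70)–(2.71a)] -/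
theorem towerBase_transferDataW_of_atoms {L b M : ℕ} [NeZero L] [NeZero (b * L)] [NeZero M] {β : ℝ} (hβ : β ≠ 0) (U μ : ℝ) (Kc Kf : TrigPolyC4v)
    {ΛT cgW Λg δ : ℝ} (hδ : 0 ≤ δ) (NG : ℕ → ℝ)
    -- the alive block and the source block of `klBaseTransferW (bL) M β μ Kc`: weighted rows and columns
    (hArow : ∀ Y : SpaceTimeIdx (b * L) M × SectorLeg (sectorCount 0), ∑ y : GridLeg (GridPoint (b * L) (klGridN M)),
      ‖((((imagTimeWeight β M : ℝ) : ℂ) • sectorAnalysisMatrix (b * L) M β (klAnisoFamily (b * L) M β μ Kc klE0 0)) * hubbardGridSub (b * L) M β (klGridN M)) Y y‖ *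
        (1 + ΛT * (Torus.tnorm (Y.1.2 - y.1.1.2) : ℝ)) ≤ cgW)
    (hAcol : ∀ y : GridLeg (GridPoint (b * L) (klGridN M)), ∑ Y : SpaceTimeIdx (b * L) M × SectorLeg (sectorCount 0),
      ‖((((imagTimeWeight β M : ℝ) : ℂ) • sectorAnalysisMatrix (b * L) M β (klAnisoFamily (b * L) M β μ Kc klE0 0)) * hubbardGridSub (b * L) M β (klGridN M)) Y y‖ *
        (1 + ΛT * (Torus.tnorm (Y.1.2 - y.1.1.2) : ℝ)) ≤ cgW)
    (hBrow : ∀ Y : SpaceTimeIdx (b * L) M × SectorLeg (sectorCount 0), ∑ y : GridLeg (GridPoint (b * L) (klGridN M)),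
      ‖(klSrcWindowBlock (b * L) M β * hubbardGridSub (b * L) M β (klGridN M)) Y y‖ * (1 + ΛT * (Torus.tnorm (Y.1.2 - y.1.1.2) : ℝ)) ≤ cgW)
    (hBcol : ∀ y : GridLeg (GridPoint (b * L) (klGridN M)), ∑ Y : SpaceTimeIdx (b * L) M × SectorLeg (sectorCount 0),
      ‖(klSrcWindowBlock (b * L) M β * hubbardGridSub (b * L) M β (klGridN M)) Y y‖ * (1 + ΛT * (Torus.tnorm (Y.1.2 - y.1.1.2) : ℝ)) ≤ cgW)
    -- the frame difference of the alive block: rows and columns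
    (hDrow : ∀ Y : SpaceTimeIdx (b * L) M × SectorLeg (sectorCount 0), ∑ y : GridLeg (GridPoint (b * L) (klGridN M)),
      ‖((((imagTimeWeight β M : ℝ) : ℂ) • (sectorAnalysisMatrix (b * L) M β (klAnisoFamily (b * L) M β μ Kf klE0 0) -
          sectorAnalysisMatrix (b * L) M β (klAnisoFamily (b * L) M β μ Kc klE0 0))) * hubbardGridSub (b * L) M β (klGridN M)) Y y‖ ≤ δ)
    (hDcol : ∀ y : GridLeg (GridPoint (b * L) (klGridN M)), ∑ Y : SpaceTimeIdx (b * L) M × SectorLeg (sectorCount 0),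
      ‖((((imagTimeWeight β M : ℝ) : ℂ) • (sectorAnalysisMatrix (b * L) M β (klAnisoFamily (b * L) M β μ Kf klE0 0) -
          sectorAnalysisMatrix (b * L) M β (klAnisoFamily (b * L) M β μ Kc klE0 0))) * hubbardGridSub (b * L) M β (klGridN M)) Y y‖ ≤ δ)
    -- the two grid actions' weighted profiles (passed through)
    (hGc : ∀ (k : ℕ) (p : Fin k) (y : GridLeg (GridPoint L (klGridN M))),
      ∑ Y ∈ univ.filter (fun Y : Fin k → GridLeg (GridPoint L (klGridN M)) => Y p = y),
        ‖kernel ℂ (klGridAction L M β U μ Kc) k Y‖ *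
          (1 + labelDiam (fun Y₁ Y₂ : GridLeg (GridPoint L (klGridN M)) => Λg * (Torus.tnorm (Y₁.1.1.2 - Y₂.1.1.2) : ℝ)) (univ.image Y)) ≤ imagTimeWeight β M * NG k)
    (hGf : ∀ (k : ℕ) (p : Fin k) (y : GridLeg (GridPoint (b * L) (klGridN M))),
      ∑ Y ∈ univ.filter (fun Y : Fin k → GridLeg (GridPoint (b * L) (klGridN M)) => Y p = y),
        ‖kernel ℂ (klGridAction (b * L) M β U μ Kf) k Y‖ *
          (1 + labelDiam (fun Y₁ Y₂ : GridLeg (GridPoint (b * L) (klGridN M)) => Λg * (Torus.tnorm (Y₁.1.1.2 - Y₂.1.1.2) : ℝ)) (univ.image Y)) ≤ imagTimeWeight β M * NG k) :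
    (∀ x : SrcLabel (b * L) M 0, ∑ y, ‖klBaseTransferW (b * L) M β μ Kc x y‖ * (1 + ΛT * (Torus.tnorm (x.1.1.2 - y.1.1.1.2) : ℝ)) ≤ cgW) ∧
    (∀ y : GridLeg (GridPoint (b * L) (klGridN M)) × Fin 2, ∑ x, ‖klBaseTransferW (b * L) M β μ Kc x y‖ * (1 + ΛT * (Torus.tnorm (x.1.1.2 - y.1.1.1.2) : ℝ)) ≤ cgW) ∧
    (∀ (δ' β' β₁ : Fin 2 → Fin b) (xbar : SrcLabel L M 0) (y : GridLeg (GridPoint L (klGridN M)) × Fin 2),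
      ‖klBaseTransferW (b * L) M β μ Kc ((klBlockEquivD L b M 0).symm (β' + δ', xbar)) ((klGridBlockEquivD L b M).symm (β₁ + δ', y))‖ =
        ‖klBaseTransferW (b * L) M β μ Kc ((klBlockEquivD L b M 0).symm (β', xbar)) ((klGridBlockEquivD L b M).symm (β₁, y))‖) ∧
    (∀ x, ∑ y, ‖klBaseTransferW (b * L) M β μ Kf x y - klBaseTransferW (b * L) M β μ Kc x y‖ ≤ δ) ∧
    (∀ y, ∑ x, ‖klBaseTransferW (b * L) M β μ Kf x y - klBaseTransferW (b * L) M β μ Kc x y‖ ≤ δ) ∧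
    (∀ (k : ℕ) (p : Fin k) (y : GridLeg (GridPoint L (klGridN M))),
      ∑ Y ∈ univ.filter (fun Y : Fin k → GridLeg (GridPoint L (klGridN M)) => Y p = y),
        ‖kernel ℂ (klGridAction L M β U μ Kc) k Y‖ *
          (1 + labelDiam (fun Y₁ Y₂ : GridLeg (GridPoint L (klGridN M)) => Λg * (Torus.tnorm (Y₁.1.1.2 - Y₂.1.1.2) : ℝ)) (univ.image Y)) ≤ imagTimeWeight β M * NG k) ∧
    (∀ (k : ℕ) (p : Fin k) (y : GridLeg (GridPoint (b * L) (klGridN M))),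
      ∑ Y ∈ univ.filter (fun Y : Fin k → GridLeg (GridPoint (b * L) (klGridN M)) => Y p = y),
        ‖kernel ℂ (klGridAction (b * L) M β U μ Kf) k Y‖ *
          (1 + labelDiam (fun Y₁ Y₂ : GridLeg (GridPoint (b * L) (klGridN M)) => Λg * (Torus.tnorm (Y₁.1.1.2 - Y₂.1.1.2) : ℝ)) (univ.image Y)) ≤ imagTimeWeight β M * NG k) :=
  ⟨sum_norm_klBaseTransferW_mul_wt_row_le β μ Kc ΛT cgW hArow hBrow, sum_norm_klBaseTransferW_mul_wt_col_le β μ Kc ΛT cgW hAcol hBcol,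
    klBaseTransferW_blockCovariant hβ μ Kc, sum_norm_klBaseTransferW_sub_row_le β μ Kf Kc hδ hDrow, sum_norm_klBaseTransferW_sub_col_le β μ Kf Kc hδ hDcol,
    hGc, hGf⟩

end Summit.HubbardSuperconductivity.HubbardSuperconductivity.Theorems.TwoVolumeSource

end
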